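import Summits.CriticalPhenomena.CardyFormulaZ2.Theorems.CardyMagicRigidityNestingRigidityNeckCoarseZ2Locality
import Literature.Probability.Percolation.BlockResampling
import Literature.Probability.Percolation.RSW
import HarnessLib

/-!
# Crux `NestingRigidity`, line `pinch-resampling` (v4), stub S12: reduction of `NeckHookupCoarseZ2` to a surrogate event

Crux `Summit.CriticalPhenomena.CardyFormulaZ2.Theses.CardyMagicRigidity.NestingRigidity`
(stmt-CriticalPhenomena-4835), line `pinch-resampling` v4, vocabulary `…PinchResamplingDefsV4` (p152476), stub S12
`stub_neckHookupCoarseZ2 : NeckHookupCoarseZ2`.  Sequel of `…NestingRigidityNeckCoarseZ2Locality` (B1); this file is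
brick B4-core of the S12 brief: the measure-theoretic half of S12, done once and for all.

* §1 The product formula under BOND percolation (generic: countable vertex type, any graph, any `p`): the
  conditional probability `condProbOff P K E` of the Defs module is `P{ξ | resample K (ω, ξ) ∈ E}` (Literature
  `resample`, `BlockResampling`); it is measurable in `ω`; resampling an ARBITRARY pair set `K` meeting only
  finitely many edges gives a fair sample (`map_resample_prod_of_finite`, from the Literature finite-block
  `map_resample_prod` and `P_p`-a.s. `ω ⊆ E(G)`); hence the disintegration identity
  `∫ 1_F · P[E | off K] dP = P(E ∩ F)` for EVERY measurable `E` and every exterior event `F`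
  (`integral_indicator_mul_condProbOff`) — the bond counterpart of `measureReal_inter_eq_integral_splice` (p151755,
  `sitePercolation` only), with no finite-ring hypothesis on `E`.
* §2 The `ℤ²` instances: `zHookProb x s` is measurable, and `P_{1/2}(ZHookR x s ∩ F) = ∫_F zHookProb x s` for every
  exterior event `F` of the box (`real_zHookR_inter_eq_integral`) — the defining property of `g^{ℤ²}` consumed by
  the identification step of S10'.
* §3 THE REDUCTION (registered anchor `neckHookupCoarseZ2_of_surrogate`): `NeckHookupCoarseZ2` follows from the
  single-configuration event estimate "in the window there is a measurable SURROGATE event `E`, reading only the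
  pairs meeting the box and the coarse datum, with `P(Sel ∩ (ZHookR Δ E)) ≤ b · P(Sel)`": put
  `G(σ) := P[E | off K]` at any configuration of coarse datum `σ` (well defined since `zCoarse` is
  exterior-determined), bound `|g − G ∘ zCoarse| ≤ P[ZHookR Δ E | off K]` pointwise, integrate over the exterior
  event `Sel` by the disintegration identity, and apply Markov (`exists_G_of_surrogate`, at `b²`).
  What is left of S12 is exactly that estimate — the Schramm–Smirnov-type discretisation of the hook-up at
  `∂Λ_s(x)` (surrogate = "hook-up through `ℓ`-fuzzy attachments to the big blobs"; error ⊆ four-arm events at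
  boundary cells ∪ boundary three-arm events at footprint ends; summable in the window because `α₄ > 1` on bond
  `ℤ²`, `QuadCrossing.fourArm_bound`, and the half-plane three-arm exponent `> 4/3`).
-/

noncomputable section

namespace Summit.CriticalPhenomena.CardyFormulaZ2.Cruxes.NestingRigidity.PinchResampling

open MeasureTheory Set Literature.Probability.Percolation Literature.Probability.LatticeModels
open ZPinchLocality NeckCoarseZ2

namespace NeckCoarseZ2

/-! ## §1 The product formula under bond percolation: resampling an arbitrary pair set -/

section Generic

variable {V : Type*}

/-- `|μ(A) − μ(B)| ≤ μ(A Δ B)` for a finite measure (outer measures: no measurability needed). -/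
theorem abs_measureReal_sub_le_symmDiff {α : Type*} [MeasurableSpace α] (μ : Measure α) [IsFiniteMeasure μ]
    (A B : Set α) : |μ.real A - μ.real B| ≤ μ.real (symmDiff A B) := by
  have h1 : μ.real A ≤ μ.real B + μ.real (symmDiff A B) :=
    calc μ.real A ≤ μ.real (B ∪ symmDiff A B) :=
          measureReal_mono (fun a ha ↦ by
            by_cases hb : a ∈ B
            · exact Or.inl hb
            · exact Or.inr (Set.mem_symmDiff.2 (Or.inl ⟨ha, hb⟩))) (measure_ne_top _ _)
      _ ≤ μ.real B + μ.real (symmDiff A B) := measureReal_union_le _ _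
  have h2 : μ.real B ≤ μ.real A + μ.real (symmDiff A B) :=
    calc μ.real B ≤ μ.real (A ∪ symmDiff A B) :=
          measureReal_mono (fun a hb ↦ by
            by_cases ha : a ∈ A
            · exact Or.inl ha
            · exact Or.inr (Set.mem_symmDiff.2 (Or.inr ⟨hb, ha⟩))) (measure_ne_top _ _)
      _ ≤ μ.real A + μ.real (symmDiff A B) := measureReal_union_le _ _
  rw [abs_sub_le_iff]
  constructor <;> linarith

/-- The product-formula conditional probability of the Defs module is the probability that the RESAMPLED
configuration `resample K (ω, ξ) = ω ∖ K ∪ (ξ ∩ K)` (Literature `BlockResampling`) lies in the event. -/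
theorem condProbOff_eq_real_resample (μ : Measure (BondConfig V)) (K : Set (Sym2 V)) (E : Set (BondConfig V))
    (ω : BondConfig V) : condProbOff μ K E ω = μ.real {ξ | resample K (ω, ξ) ∈ E} := by
  simp only [condProbOff, resample_apply, union_comm (ω \ K)]

/-- **`P[E | off K](ω) - P[E' | off K](ω)` is at most `P[E Δ E' | off K](ω)`.** -/
theorem abs_condProbOff_sub_le (μ : Measure (BondConfig V)) [IsFiniteMeasure μ] (K : Set (Sym2 V))
    (E E' : Set (BondConfig V)) (ω : BondConfig V) :
    |condProbOff μ K E ω - condProbOff μ K E' ω| ≤ condProbOff μ K (symmDiff E E') ω := by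
  simp only [condProbOff_eq_real_resample]
  have h : {ξ | resample K (ω, ξ) ∈ symmDiff E E'} =
      symmDiff {ξ | resample K (ω, ξ) ∈ E} {ξ | resample K (ω, ξ) ∈ E'} := by
    ext ξ
    simp only [mem_setOf_eq, Set.mem_symmDiff]
  rw [h]
  exact abs_measureReal_sub_le_symmDiff μ _ _

/-- **`ω ↦ P[E | off K](ω)` is measurable** for `E` measurable (sections of a measurable set of the product). -/
theorem measurable_condProbOff (μ : Measure (BondConfig V)) [SFinite μ] (K : Set (Sym2 V))
    {E : Set (BondConfig V)} (hE : MeasurableSet E) : Measurable (condProbOff μ K E) := by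
  have h : condProbOff μ K E = fun ω ↦ (μ (Prod.mk ω ⁻¹' (resample K ⁻¹' E))).toReal := by
    funext ω
    rw [condProbOff_eq_real_resample]
    rfl
  rw [h]
  exact (measurable_measure_prodMk_left (measurable_resample K hE)).ennreal_toReal

/-- The resampled configuration agrees with the second sample on `K` … -/
theorem resample_inter (K : Set (Sym2 V)) (ω ξ : BondConfig V) : resample K (ω, ξ) ∩ K = ξ ∩ K := by
  ext e
  simp only [mem_inter_iff, mem_resample_iff]
  tauto

/-- … and with the first sample off `K`. -/
theorem resample_inter_compl (K : Set (Sym2 V)) (ω ξ : BondConfig V) : resample K (ω, ξ) ∩ Kᶜ = ω ∩ Kᶜ := by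
  ext e
  simp only [mem_inter_iff, mem_resample_iff, mem_compl_iff]
  tauto

/-- On an event determined by `Kᶜ`, membership of the resampled configuration is membership of the first
sample. -/
theorem resample_mem_iff_of_determinedBy {F : Set (BondConfig V)} {K : Set (Sym2 V)} (hF : DeterminedBy F Kᶜ)
    (ω ξ : BondConfig V) : resample K (ω, ξ) ∈ F ↔ ω ∈ F :=
  (determinedBy_iff F Kᶜ).1 hF _ _ (resample_inter_compl K ω ξ)

variable [Countable V] (G : SimpleGraph V) (p : unitInterval)

/-- **Resampling an arbitrary pair set gives a fair sample.**  For Bernoulli bond percolation `P_p` on a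
countable graph and ANY pair set `K` meeting only finitely many edges of `G`, the law of `resample K (ω, ξ)`
under `P_p ⊗ P_p` is `P_p`: `P_p`-a.s. configurations are subsets of the edge set (`ae_subset_edgeSet`), on
which `resample K = resample (K ∩ E(G))`, a finite block (Literature `map_resample_prod`). -/
theorem map_resample_prod_of_finite (K : Set (Sym2 V)) (hK : (K ∩ G.edgeSet).Finite) :
    ((bondPercolation G p).prod (bondPercolation G p)).map (resample K) = bondPercolation G p := by
  have hBK : (↑hK.toFinset : Set (Sym2 V)) = K ∩ G.edgeSet := hK.coe_toFinset
  have h1 : ∀ᵐ x ∂(bondPercolation G p).prod (bondPercolation G p), x.1 ⊆ G.edgeSet := by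
    have h : ∀ᵐ ω ∂((bondPercolation G p).prod (bondPercolation G p)).map Prod.fst, ω ⊆ G.edgeSet := by
      rw [Measure.map_fst_prod, measure_univ, one_smul]
      exact ae_subset_edgeSet G p
    exact ae_of_ae_map measurable_fst.aemeasurable h
  have h2 : ∀ᵐ x ∂(bondPercolation G p).prod (bondPercolation G p), x.2 ⊆ G.edgeSet := by
    have h : ∀ᵐ ω ∂((bondPercolation G p).prod (bondPercolation G p)).map Prod.snd, ω ⊆ G.edgeSet := by
      rw [Measure.map_snd_prod, measure_univ, one_smul]
      exact ae_subset_edgeSet G p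
    exact ae_of_ae_map measurable_snd.aemeasurable h
  have hae : resample K =ᵐ[(bondPercolation G p).prod (bondPercolation G p)] resample ↑hK.toFinset := by
    filter_upwards [h1, h2] with x hx1 hx2
    ext e
    have he1 : e ∈ x.1 → e ∈ G.edgeSet := fun h ↦ hx1 h
    have he2 : e ∈ x.2 → e ∈ G.edgeSet := fun h ↦ hx2 h
    have heB : e ∈ (↑hK.toFinset : Set (Sym2 V)) ↔ e ∈ K ∧ e ∈ G.edgeSet := by
      rw [hBK]
      rfl
    rw [mem_resample_iff, mem_resample_iff, heB]
    tauto
  rw [Measure.map_congr hae, map_resample_prod G p hK.toFinset]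

/-- **The product formula is the conditional probability given the pairs off `K` (disintegration identity).**
For `P_p` on a countable graph, a pair set `K` meeting finitely many edges, ANY measurable event `E` and any
EXTERIOR event `F` (measurable, `DeterminedBy F Kᶜ`):  `∫ 1_F(ω) · P_p[E | off K](ω) dP_p(ω) = P_p(E ∩ F)`.
(Fair sample + Tonelli on the product; the bond-`ℤ²` counterpart of `measureReal_inter_eq_integral_splice`,
p151755, with no finite-ring hypothesis on `E`.) -/
theorem integral_indicator_mul_condProbOff (K : Set (Sym2 V)) (hK : (K ∩ G.edgeSet).Finite)
    {E F : Set (BondConfig V)} (hE : MeasurableSet E) (hF : MeasurableSet F) (hFK : DeterminedBy F Kᶜ) :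
    ∫ ω, F.indicator 1 ω * condProbOff (bondPercolation G p) K E ω ∂(bondPercolation G p) =
      (bondPercolation G p).real (E ∩ F) := by
  have hs : MeasurableSet (resample K ⁻¹' (E ∩ F)) := measurable_resample K (hE.inter hF)
  have hR : ((bondPercolation G p).prod (bondPercolation G p)).real (resample K ⁻¹' (E ∩ F)) =
      (bondPercolation G p).real (E ∩ F) := by
    rw [measureReal_def, measureReal_def, ← Measure.map_apply (measurable_resample K) (hE.inter hF),
      map_resample_prod_of_finite G p K hK]
  rw [← hR, measureReal_prod_eq_integral G p hs]
  refine integral_congr_ae (Filter.Eventually.of_forall fun ω ↦ ?_)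
  change F.indicator 1 ω * condProbOff (bondPercolation G p) K E ω =
    (bondPercolation G p).real (Prod.mk ω ⁻¹' (resample K ⁻¹' (E ∩ F)))
  have hmemF : ∀ ξ, resample K (ω, ξ) ∈ F ↔ ω ∈ F := resample_mem_iff_of_determinedBy hFK ω
  by_cases hω : ω ∈ F
  · rw [indicator_of_mem hω, Pi.one_apply, one_mul, condProbOff_eq_real_resample]
    congr 1
    ext ξ
    simp only [mem_setOf_eq, mem_preimage, mem_inter_iff, hmemF, hω, and_true]
  · rw [indicator_of_notMem hω, zero_mul]
    have h0 : Prod.mk ω ⁻¹' (resample K ⁻¹' (E ∩ F)) = ∅ :=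
      eq_empty_of_forall_notMem fun ξ h ↦ hω ((hmemF ξ).1 h.2)
    rw [h0, measureReal_empty]

end Generic

end NeckCoarseZ2

/-! ## §2 The `ℤ²` instances -/

/-- **`ω ↦ g^{ℤ²}_{x,s}(ω)` is measurable.** -/
theorem measurable_zHookProb (x : Site 2) (s : ℕ) : Measurable (zHookProb x s) :=
  measurable_condProbOff _ _ (measurableSet_zHookR x s)

/-- **The defining property of `g^{ℤ²}_{x,s}`** (`ℤ²` twin of `real_tHook_inter_eq_integral_splice`): for every
exterior event `F` of the box `Λ_s(x)` (measurable, determined by the pairs with no endpoint in the box),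
`P_{1/2}(ZHookR x s ∩ F) = ∫_F zHookProb x s dP_{1/2}` — the product-formula hook-up probability of the box given
its exterior edges is a version of the conditional probability.  Consumed by the identification step of S10'. -/
theorem real_zHookR_inter_eq_integral (x : Site 2) (s : ℕ) {F : Set (BondConfig (Site 2))}
    (hFm : MeasurableSet F) (hF : DeterminedBy F (zExtEdges x s)) :
    (bondPercolation (zdGraph 2) half).real (ZHookR x s ∩ F) =
      ∫ ω, F.indicator 1 ω * zHookProb x s ω ∂(bondPercolation (zdGraph 2) half) := by
  have hF' : DeterminedBy F (zExtEdges x s)ᶜᶜ := by rwa [compl_compl]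
  exact (integral_indicator_mul_condProbOff (zdGraph 2) half (zExtEdges x s)ᶜ
    (finite_compl_zExtEdges_inter_edgeSet x s) (measurableSet_zHookR x s) hFm hF').symm

/-! ## §3 The reduction of S12 to a surrogate-event estimate -/

/-- **Reduction of S12 at fixed parameters.**  If a measurable event `E` reads only the pairs meeting the box and
the coarse datum (`ω ∩ (zExtEdges x s)ᶜ` and `zCoarse ℓ lam s x o ω`) and differs from the primal hook-up on a part
of the selection event of probability `≤ b² · P(Sel)`, then `G(σ) := P[E | off the box]` (read at any configuration
of coarse datum `σ`) satisfies the conclusion of `NeckHookupCoarseZ2` at these parameters: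
`P(Sel ∩ {b < |g − G ∘ zCoarse|}) ≤ b · P(Sel)`.  Proof: `G ∘ zCoarse = P[E | off K]` exactly; `|g − P[E | off K]|
≤ P[ZHookR Δ E | off K]` pointwise; `∫_{Sel} P[ZHookR Δ E | off K] = P(Sel ∩ (ZHookR Δ E))` since `Sel` is an
exterior event (`integral_indicator_mul_condProbOff`); Markov. -/
theorem exists_G_of_surrogate {b : ℝ} (hb : 0 < b) (x o : Site 2) (ℓ lam s : ℕ)
    {E : Set (BondConfig (Site 2))} (hEm : MeasurableSet E)
    (hdep : ∀ ω ω' : BondConfig (Site 2), ω ∩ (zExtEdges x s)ᶜ = ω' ∩ (zExtEdges x s)ᶜ →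
      zCoarse ℓ lam s x o ω = zCoarse ℓ lam s x o ω' → ω ∈ E → ω' ∈ E)
    (hbound : (bondPercolation (zdGraph 2) half).real (ZFourStrands x s ∩ symmDiff (ZHookR x s) E) ≤
      b ^ 2 * (bondPercolation (zdGraph 2) half).real (ZFourStrands x s)) :
    ∃ G : Set (Set (Site 2)) × Set (Set (Site 2)) → ℝ,
      (bondPercolation (zdGraph 2) half).real
          (ZFourStrands x s ∩ {ω | b < |zHookProb x s ω - G (zCoarse ℓ lam s x o ω)|}) ≤
        b * (bondPercolation (zdGraph 2) half).real (ZFourStrands x s) := by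
  classical
  -- (1) the surrogate conditional probability `gE = P[E | off K]` is a function of the coarse datum
  have hdep' : ∀ ω ω' : BondConfig (Site 2), zCoarse ℓ lam s x o ω = zCoarse ℓ lam s x o ω' →
      condProbOff (bondPercolation (zdGraph 2) half) (zExtEdges x s)ᶜ E ω =
        condProbOff (bondPercolation (zdGraph 2) half) (zExtEdges x s)ᶜ E ω' := by
    intro ω ω' hωω'
    simp only [condProbOff_eq_real_resample]
    congr 1
    ext ξ
    have hK : ∀ ζ : BondConfig (Site 2),
        resample (zExtEdges x s)ᶜ (ζ, ξ) ∩ (zExtEdges x s)ᶜ = ξ ∩ (zExtEdges x s)ᶜ :=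
      fun ζ ↦ resample_inter _ ζ ξ
    have hc : ∀ ζ : BondConfig (Site 2),
        zCoarse ℓ lam s x o (resample (zExtEdges x s)ᶜ (ζ, ξ)) = zCoarse ℓ lam s x o ζ := fun ζ ↦
      zCoarse_congr_of_inter_zExtEdges (by
        have h := resample_inter_compl (zExtEdges x s)ᶜ ζ ξ
        rwa [compl_compl] at h)
    exact ⟨hdep _ _ ((hK ω).trans (hK ω').symm) (by rw [hc, hc, hωω']),
      hdep _ _ ((hK ω').trans (hK ω).symm) (by rw [hc, hc, hωω'])⟩
  set G : Set (Set (Site 2)) × Set (Set (Site 2)) → ℝ := fun σ ↦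
    if h : ∃ ω, zCoarse ℓ lam s x o ω = σ then
      condProbOff (bondPercolation (zdGraph 2) half) (zExtEdges x s)ᶜ E h.choose else 0 with hGdef
  have hG : ∀ ω, G (zCoarse ℓ lam s x o ω) = condProbOff (bondPercolation (zdGraph 2) half) (zExtEdges x s)ᶜ E ω := by
    intro ω
    have h : ∃ ω', zCoarse ℓ lam s x o ω' = zCoarse ℓ lam s x o ω := ⟨ω, rfl⟩
    rw [hGdef]
    simp only [dif_pos h]
    exact hdep' _ _ h.choose_spec
  -- (2) the error conditional probability `hD = P[ZHookR Δ E | off K]` dominates `|g - gE|`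
  have hDm : MeasurableSet (symmDiff (ZHookR x s) E) := (measurableSet_zHookR x s).symmDiff hEm
  have hdiff : ∀ ω, |zHookProb x s ω - condProbOff (bondPercolation (zdGraph 2) half) (zExtEdges x s)ᶜ E ω| ≤
      condProbOff (bondPercolation (zdGraph 2) half) (zExtEdges x s)ᶜ (symmDiff (ZHookR x s) E) ω :=
    fun ω ↦ abs_condProbOff_sub_le _ _ _ _ ω
  -- (3) Markov for `f = 1_{Sel} · hD`
  set f : BondConfig (Site 2) → ℝ := fun ω ↦ (ZFourStrands x s).indicator 1 ω *
    condProbOff (bondPercolation (zdGraph 2) half) (zExtEdges x s)ᶜ (symmDiff (ZHookR x s) E) ω with hfdef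
  have hf_meas : Measurable f :=
    (measurable_const.indicator (measurableSet_zFourStrands x s)).mul (measurable_condProbOff _ _ hDm)
  have hf_nonneg : ∀ ω, 0 ≤ f ω := fun ω ↦
    mul_nonneg (indicator_nonneg (fun _ _ ↦ zero_le_one) ω) (condProbOff_mem_Icc _ _ _ ω).1
  have hf_le : ∀ ω, f ω ≤ 1 := fun ω ↦
    mul_le_one₀ (indicator_apply_le' (fun _ ↦ le_rfl) (fun _ ↦ zero_le_one)) (condProbOff_mem_Icc _ _ _ ω).1
      (condProbOff_mem_Icc _ _ _ ω).2
  have hf_int : Integrable f (bondPercolation (zdGraph 2) half) :=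
    Integrable.of_bound hf_meas.aestronglyMeasurable 1 (ae_of_all _ fun ω ↦ by
      rw [Real.norm_eq_abs, abs_of_nonneg (hf_nonneg ω)]
      exact hf_le ω)
  have hmarkov := mul_meas_ge_le_integral_of_nonneg (ae_of_all _ hf_nonneg) hf_int b
  have hdet : DeterminedBy (ZFourStrands x s) (zExtEdges x s)ᶜᶜ := by
    rw [compl_compl]
    exact zFourStrands_determinedBy x s
  have hint : ∫ ω, f ω ∂(bondPercolation (zdGraph 2) half) =
      (bondPercolation (zdGraph 2) half).real (symmDiff (ZHookR x s) E ∩ ZFourStrands x s) :=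
    integral_indicator_mul_condProbOff (zdGraph 2) half (zExtEdges x s)ᶜ
      (finite_compl_zExtEdges_inter_edgeSet x s) hDm (measurableSet_zFourStrands x s) hdet
  -- (4) assembly
  refine ⟨G, ?_⟩
  have hsub : ZFourStrands x s ∩ {ω | b < |zHookProb x s ω - G (zCoarse ℓ lam s x o ω)|} ⊆ {ω | b ≤ f ω} := by
    rintro ω ⟨hωS, hωb⟩
    rw [mem_setOf_eq, hG] at hωb
    rw [mem_setOf_eq, hfdef]
    simp only [indicator_of_mem hωS, Pi.one_apply, one_mul]
    exact hωb.le.trans (hdiff ω)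
  calc (bondPercolation (zdGraph 2) half).real
        (ZFourStrands x s ∩ {ω | b < |zHookProb x s ω - G (zCoarse ℓ lam s x o ω)|})
      ≤ (bondPercolation (zdGraph 2) half).real {ω | b ≤ f ω} := measureReal_mono hsub (measure_ne_top _ _)
    _ ≤ (∫ ω, f ω ∂(bondPercolation (zdGraph 2) half)) / b := by
        rw [le_div_iff₀ hb, mul_comm]
        exact hmarkov
    _ = (bondPercolation (zdGraph 2) half).real (ZFourStrands x s ∩ symmDiff (ZHookR x s) E) / b := by
        rw [hint, inter_comm]
    _ ≤ b ^ 2 * (bondPercolation (zdGraph 2) half).real (ZFourStrands x s) / b :=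
        div_le_div_of_nonneg_right hbound hb.le
    _ = b * (bondPercolation (zdGraph 2) half).real (ZFourStrands x s) := by
        field_simp

/-- **B4-core of S12 (registered helper): `NeckHookupCoarseZ2` reduces to a surrogate-event estimate.**  If for
every `b > 0` there is a scale ratio `L` such that in the window `1 ≤ ℓ`, `s³ ℓ ≤ lam⁴`, `L · lam ≤ s` there is a
measurable event `E` reading only the pairs meeting `Λ_s(x)` and the coarse blob datum `zCoarse ℓ lam s x o` with
`P_{1/2}(ZFourStrands x s ∩ (ZHookR x s Δ E)) ≤ b · P_{1/2}(ZFourStrands x s)`, then `NeckHookupCoarseZ2` holds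
(`exists_G_of_surrogate` at `b²`).  The hypothesis is the Schramm–Smirnov-type discretisation of the hook-up at the
box boundary — the percolation content of S12; everything else is here. -/
theorem neckHookupCoarseZ2_of_surrogate : (∀ b : ℝ, 0 < b → ∃ L : ℕ, ∀ (x o : Site 2) (ℓ lam s : ℕ), 1 ≤ ℓ → s ^ 3 * ℓ ≤ lam ^ 4 → L * lam ≤ s → ∃ E : Set (BondConfig (Site 2)), MeasurableSet E ∧ (∀ ω ω' : BondConfig (Site 2), ω ∩ (zExtEdges x s)ᶜ = ω' ∩ (zExtEdges x s)ᶜ → zCoarse ℓ lam s x o ω = zCoarse ℓ lam s x o ω' → ω ∈ E → ω' ∈ E) ∧ (bondPercolation (zdGraph 2) half).real (ZFourStrands x s ∩ symmDiff (ZHookR x s) E) ≤ b * (bondPercolation (zdGraph 2) half).real (ZFourStrands x s)) → NeckHookupCoarseZ2 := by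
  intro h b hb
  obtain ⟨L, hL⟩ := h (b ^ 2) (by positivity)
  refine ⟨L, fun x o ℓ lam s hℓ hwin hLs ↦ ?_⟩
  obtain ⟨E, hEm, hdep, hbound⟩ := hL x o ℓ lam s hℓ hwin hLs
  exact exists_G_of_surrogate hb x o ℓ lam s hEm hdep hbound

end Summit.CriticalPhenomena.CardyFormulaZ2.Cruxes.NestingRigidity.PinchResampling

end
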